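import Summits.BirchSwinnertonDyer.BirchSwinnertonDyer.Theorems.GenusKolyvaginAtTwoMinimalTwinBSDTwoSwappedPairSilentDescent
import Summits.BirchSwinnertonDyer.BirchSwinnertonDyer.Theorems.GenusKolyvaginAtTwoGenusPrimitiveSupplyAtTwoPrimeHeegnerTwin
import HarnessLib

/-!
# Route `GenusKolyvaginAtTwo`, crux U₂ `MinimalTwinBSDTwo` (stmt-BirchSwinnertonDyer-22985), the defect-2 cell `hTw2 = (Δ > 0, ord₂ C = 2)`:
# ON A PRIME HEEGNER FIELD WHOSE PRIME IS INERT IN THE CUBIC FIELD THE SILENT BUDGET IS AUTOMATIC — `ord₂ C(Wd) = ord₂ C(W)` for `d_K = −ℓ`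
# with the `2`-division cubic of `W` irreducible mod `ℓ` — so the reversed supply S2⁼ needs no Tamagawa clause on that prime frame

Seat `bsd-line-gk2-p3` g28 (PROVER seat 3/3, cell `bsd-f1-sign2`), `--supports stmt-BirchSwinnertonDyer-22985` (helper; closes nothing).
THEOREMS ONLY (no definition, no named fact, no `sorry`); standard axioms.  **BSD is NOT proved by this file; U₂ / hTw2 are NOT proved; no item
is closed.**  §1 is UNCONDITIONAL; §2 is CONDITIONAL on its displayed hypotheses (the rank-`0` wall S1, the prime-frame reversed supply S2⁼′, and
the four PRINT facts), exactly as `Silent.hTw2_of_wall_of_reversedSupplySilent_of_facts` (`…SwappedPairSilentDescent`).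

WHY.  The all-silent swapped sandwich (`…SwappedPairSilent`, p767255) asks `ord₂ C(Wd) = ord₂ C(W)`: every prime of `d_K` silent, i.e. the
`2`-division cubic of `W` has NO root mod `q` (`#W̃(𝔽_q)[2] = 1`).  For a prime Heegner discriminant `d_K = −ℓ` this is ONE Čebotarev condition
(«`Frob_ℓ` of order `3` in `Gal(ℚ(W[2])/ℚ)`», Kriz–Li's set `𝒮` shape), so the instrument form of S2⁼ is «first admissible prime `ℓ` with the cubic
irreducible mod `ℓ`» and NO Tamagawa clause:

* §1 **`padicValNat_two_tamagawaProduct_twin_eq_of_discr_eq_neg_prime_of_noRoot`** — `W` globally minimal (any `C(W)`, any sign of `Δ`), `K` with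
  `d_K = −ℓ` (`ℓ` prime), `d_K` odd, Heegner for `N_W`, and the `2`-division cubic of `W` without a root mod `ℓ`; `Wd = Cd • W^(d_K)` any model:
  **`ord₂ C(Wd) = ord₂ C(W)`** (this seat's hT-free identity, p766610 §1, with `#roots_ℓ = 0`).  UNCONDITIONAL.
* §2 **`hTw2_of_wall_of_reversedSupplySilentPrime_of_facts`** — **`hTw2 ⟸ S1 + S2⁼′ + PRINT`**, S2⁼′ = S2⁼ with the Tamagawa clause replaced by
  «`d_K = −ℓ`, `ℓ` prime, no root of the cubic mod `ℓ`».

References: [Kramer1981] §2 Prop. 3; [GrossLMS1991] §1; [KrizLi2019] Def. 4.1 (the set 𝒮); [GrossZagier1986] V.§2 (2.2); [Milne1972ArithmeticAV]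
§1 Thm. 1; [Miller2011LMS] Def. 1.1.
-/

set_option autoImplicit false
set_option linter.dupNamespace false -- `Summit.<P>.<Sub>` repeats `BirchSwinnertonDyer` (D-0017)

noncomputable section

open scoped Classical

open WeierstrassCurve NumberField Literature.NumberTheory.EllipticCurves
  Literature.NumberTheory.EllipticCurves.ModularForms
  Literature.NumberTheory.EllipticCurves.Rank1Residual
  Literature.NumberTheory.EllipticCurves.Rank1Residual.Typed
  Literature.NumberTheory.EllipticCurves.KrizLi2019
  Summit.BirchSwinnertonDyer.Rank1Residual
  Summit.BirchSwinnertonDyer.Rank1Residual.AdditivePotMult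
  Summit.BirchSwinnertonDyer.BirchSwinnertonDyer.Rank1Residual
  Summit.BirchSwinnertonDyer.BirchSwinnertonDyer.Theorems.CMExactDescent
  Summit.BirchSwinnertonDyer.BirchSwinnertonDyer.Theorems.GenusExact.TwinSwap
  Summit.BirchSwinnertonDyer.BirchSwinnertonDyer.Theorems.GenusExact.TwinSwap.OneBit
  Summit.BirchSwinnertonDyer.BirchSwinnertonDyer.Theorems.GenusExact.PlusDescent

namespace Summit.BirchSwinnertonDyer.BirchSwinnertonDyer.Theorems.GenusExact.TwinSwap.Silent

/-! ## §1 Prime Heegner discriminant with the cubic irreducible mod `ℓ`: the twist is silent, for any `C(W)` -/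

/-- **`ord₂ C(Wd) = ord₂ C(W)` for a prime Heegner discriminant whose prime sees no root of the `2`-division cubic** (UNCONDITIONAL, no parity
hypothesis on `C(W)`, any sign of `Δ`).  `W/ℚ` globally minimal; `K` imaginary quadratic with `d_K = −ℓ`, `ℓ` prime, `d_K` odd, Heegner for `N_W`;
the cubic `4x³ + b₂x² + 2b₄x + b₆` of the integral minimal model has no root mod `ℓ`; `Wd = Cd • W^(d_K)` any elliptic model.  From
`(∏_{q∣d_K}(1+#roots_q))·2^{ord₂ C(W)} = 2^{ord₂ C(Wd)}` (p766610) with `#roots_ℓ = 0`.  [cite: Kramer1981, §2 Prop. 3] [cite: GrossLMS1991, §1 (p. 235)] -/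
theorem padicValNat_two_tamagawaProduct_twin_eq_of_discr_eq_neg_prime_of_noRoot
    (W : WeierstrassCurve ℚ) [W.IsElliptic] [W.IsGloballyMinimal]
    {K : Type} [Field K] [NumberField K] (hK : IsImaginaryQuadratic K) (hodd : Odd (NumberField.discr K))
    (hH : SatisfiesHeegnerHypothesis (W.conductorNorm ℤ) K) {ℓ : ℕ} (hℓ : ℓ.Prime) (hd : NumberField.discr K = -(ℓ : ℤ))
    (hnoRoot : ∀ x : ZMod ℓ, 4 * x ^ 3 + ((integralModelInt W).b₂ : ZMod ℓ) * x ^ 2 +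
      2 * ((integralModelInt W).b₄ : ZMod ℓ) * x + ((integralModelInt W).b₆ : ZMod ℓ) ≠ 0)
    {Wd : WeierstrassCurve ℚ} [Wd.IsElliptic] (Cd : VariableChange ℚ)
    (hWd : Cd • W.quadraticTwist (NumberField.discr K : ℚ) = Wd) :
    padicValNat 2 Wd.tamagawaProduct = padicValNat 2 W.tamagawaProduct := by
  have h := prod_ncard_roots_add_one_mul_eq_two_pow_padicValNat_tamagawaProduct_twin W hK hodd hH Cd hWd
  have hnat : (NumberField.discr K).natAbs = ℓ := by rw [hd, Int.natAbs_neg, Int.natAbs_natCast]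
  have hempty : {x : ZMod ℓ | 4 * x ^ 3 + ((integralModelInt W).b₂ : ZMod ℓ) * x ^ 2 +
      2 * ((integralModelInt W).b₄ : ZMod ℓ) * x + ((integralModelInt W).b₆ : ZMod ℓ) = 0} = ∅ :=
    Set.eq_empty_iff_forall_notMem.mpr fun x hx ↦ hnoRoot x hx
  rw [hnat, Nat.Prime.primeFactors hℓ, Finset.prod_singleton, hempty, Set.ncard_empty, zero_add, one_mul] at h
  exact (Nat.pow_right_injective le_rfl h).symm

/-! ## §2 The defect-2 cell `hTw2` from the wall, the PRIME-FRAME silent reversed supply and PRINT -/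

/-- **`hTw2 ⟸ S1 + S2⁼′ + PRINT` on the prime frame** (pure logic over `…SwappedPairSilentDescent` §1 and §1 above).  With `hS1` — LINE 23's anchor
S1 (`MinimalRankZeroBSDTwo`, pen v1.1 text verbatim), and `hS2p` — S2⁼′: for `W` non-CM, `r_an = 1`, `#Sel₂ = 2`, `0 < Δ`, `ord₂ C(W) = 2`: some
imaginary quadratic `K` with **`d_K = −ℓ`, `ℓ` prime, and the `2`-division cubic of `W` without a root mod `ℓ`**, `d_K` odd `≠ −3`, Heegner for `N_W`,
a datum (`c ≠ 0`), a conductor-`1` datum with `P(1)` of infinite order and `2^(ord₂ c + 2) ∥ P(1)` in `E(K[1])`, and a globally minimal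
`2`-Selmer-trivial twin `Wd ≅ E^(d_K)` — NO Tamagawa clause; and the four PRINT items: **every `W` on `hTw2 = (Δ > 0, ord₂ C = 2)` satisfies
`BSD₂`**.  CONDITIONAL on the displayed hypotheses; BSD is NOT proved; nothing is closed.
[cite: GrossZagier1986, V.§2 (2.2)] [cite: Milne1972ArithmeticAV, §1 Thm. 1] [cite: Kramer1981, §2 Prop. 3] [cite: Miller2011LMS, Def. 1.1] -/
theorem hTw2_of_wall_of_reversedSupplySilentPrime_of_facts
    (hGZ : ∀ (N : ℕ) [NeZero N] (W : WeierstrassCurve ℚ) (K : Type) [Field K] [NumberField K], gross_zagier N W K)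
    (hGZK : rank_eq_analyticRank_of_analyticRank_le_one) (hmod : hasEntireLFunction_rat)
    (hMilneC : Milne1972.bsdQuotient_baseChange_quadratic_anyModel)
    (hS1 : ∀ (W : WeierstrassCurve ℚ) [W.IsElliptic] [W.IsGloballyMinimal],
      ¬ W.HasCM → W.analyticRank = 0 → Nat.card (W.selmerGroup 2) = 1 → BSDp W 2)
    (hS2p : ∀ (W : WeierstrassCurve ℚ) [W.IsElliptic] [W.IsGloballyMinimal] [NeZero (W.conductorNorm ℤ)],
      ¬ W.HasCM → W.analyticRank = 1 → Nat.card (W.selmerGroup 2) = 2 → 0 < W.Δ → padicValNat 2 W.tamagawaProduct = 2 →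
      ∃ (K : Type) (_ : Field K) (_ : NumberField K),
        IsImaginaryQuadratic K ∧
        (∃ ℓ : ℕ, ℓ.Prime ∧ NumberField.discr K = -(ℓ : ℤ) ∧
          ∀ x : ZMod ℓ, 4 * x ^ 3 + ((integralModelInt W).b₂ : ZMod ℓ) * x ^ 2 +
            2 * ((integralModelInt W).b₄ : ZMod ℓ) * x + ((integralModelInt W).b₆ : ZMod ℓ) ≠ 0) ∧
        Odd (NumberField.discr K) ∧ NumberField.discr K ≠ -3 ∧ SatisfiesHeegnerHypothesis (W.conductorNorm ℤ) K ∧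
        ∃ (Dt : ModularParametrizationData W (W.conductorNorm ℤ)) (β : ℤ) (ι : K →+* ℂ) (d₁ : KolyvaginHeegnerData Dt β ι 1),
          Dt.c ≠ 0 ∧ ¬ IsOfFinAddOrder d₁.derivedPoint ∧
          (∃ Q : (W.baseChange (ringClassField K ι 1)).toAffine.Point,
            ((2 ^ (padicValInt 2 Dt.c + 2) : ℕ) : ℤ) • Q = d₁.derivedPoint) ∧
          (¬ ∃ Q : (W.baseChange (ringClassField K ι 1)).toAffine.Point,
            ((2 ^ (padicValInt 2 Dt.c + 2 + 1) : ℕ) : ℤ) • Q = d₁.derivedPoint) ∧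
          ∃ (Wd : WeierstrassCurve ℚ) (_ : Wd.IsElliptic) (_ : Wd.IsGloballyMinimal),
            (∃ C : WeierstrassCurve.VariableChange ℚ, C • W.quadraticTwist (NumberField.discr K : ℚ) = Wd) ∧
            Nat.card (Wd.selmerGroup 2) = 1) :
    ∀ (W : WeierstrassCurve ℚ) [W.IsElliptic] [W.IsGloballyMinimal], ¬ W.HasCM → W.analyticRank = 1 →
      Nat.card (W.selmerGroup 2) = 2 → 0 < W.Δ → padicValNat 2 W.tamagawaProduct = 2 → BSDp W 2 := by
  intro W _ _ hcm hr hSel hΔ hC2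
  haveI : NeZero (W.conductorNorm ℤ) := ⟨(W.conductorNorm_pos_holds).ne'⟩
  obtain ⟨K, iF, iN, hK, ⟨ℓ, hℓ, hd, hnoRoot⟩, hodd, h3, hH, Dt, β, ι, d₁, hc0, hy, hdiv, hndiv, Wd, iE, iM, hWd, hSel1⟩ :=
    hS2p W hcm hr hSel hΔ hC2
  haveI hEK : (W.baseChange K).IsElliptic := isElliptic_baseChange' W K
  have hD0 : (NumberField.discr K : ℚ) ≠ 0 := by exact_mod_cast NumberField.discr_ne_zero K
  haveI hEt : (W.quadraticTwist (NumberField.discr K : ℚ)).IsElliptic := W.isElliptic_quadraticTwist hD0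
  obtain ⟨Cd, hCd⟩ := hWd
  -- the silent budget is automatic on this prime frame
  have hSil : padicValNat 2 Wd.tamagawaProduct = padicValNat 2 W.tamagawaProduct :=
    padicValNat_two_tamagawaProduct_twin_eq_of_discr_eq_neg_prime_of_noRoot W hK hodd hH hℓ hd hnoRoot Cd hCd
  have hdiv' : ∃ Q : (W.baseChange (ringClassField K ι 1)).toAffine.Point,
      ((2 ^ (padicValInt 2 Dt.c + padicValNat 2 W.tamagawaProduct) : ℕ) : ℤ) • Q = d₁.derivedPoint := by rw [hC2]; exact hdiv
  have hndiv' : ¬ ∃ Q : (W.baseChange (ringClassField K ι 1)).toAffine.Point,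
      ((2 ^ (padicValInt 2 Dt.c + padicValNat 2 W.tamagawaProduct + 1) : ℕ) : ℤ) • Q = d₁.derivedPoint := by rw [hC2]; exact hndiv
  -- the twin is non-CM (same `j`) of analytic rank `0`: `BSD₂(Wd)` from S1
  have hcmd : ¬ Wd.HasCM := by
    rw [← hCd, hasCM_iff_of_j_eq (((W.quadraticTwist (NumberField.discr K : ℚ)).variableChange_j Cd).trans (W.j_quadraticTwist hD0))]
    exact hcm
  have hrk : 1 ≤ W.mordellWeilRank := one_le_mordellWeilRank_of_reversedFrame W K hK hH ι d₁ hy Cd hCd hSel1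
  obtain ⟨-, hsha⟩ := natCard_primaryComponent_sha_baseChange_two_eq_one_of_swappedPair_silent W K hK hodd hH hrk hSel Cd hCd
    hSel1 hSil
  obtain ⟨hrd, -⟩ := padicValRat_shaAn_and_shaOrder_of_swappedPair_of_sha_trivial W K (hGZ _ W K) hGZK hmod hr hSel hK hodd h3 hH Dt
    hc0 β ι d₁ hy hdiv' hndiv' Wd Cd hCd hSel1 hsha
  have hBd : BSDp Wd 2 := hS1 Wd hcmd hrd hSel1
  exact swappedPairDescentAtTwo_silent_of_facts hGZ hGZK hmod hMilneC W hr hSel K hK hodd h3 hH Dt hc0 β ι d₁ hy hdiv' hndiv'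
    Wd ⟨Cd, hCd⟩ hSel1 hSil hBd

end Summit.BirchSwinnertonDyer.BirchSwinnertonDyer.Theorems.GenusExact.TwinSwap.Silent

end
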